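import Mathlib
import HarnessLib
import Literature.MathematicalPhysics.QuantumLattice.HubbardSectorPhaseSpaceCount
import Summits.HubbardSuperconductivity.HubbardSuperconductivity.Theorems.KLProgrammeC4aSliceMoment

/-!
# Route `KLProgramme` — crux C4a, value layer (k = 0): the slice moment SUMMED OVER THE MATSUBARA FREQUENCIES —
# `Σ_{p₀} ∫_{(−r,r)} ‖ŝ(ω_{p₀},ξ)‖·(|ξ| + |ω_{p₀}|) dξ ≤ 4|c|·Λ′·(Λ′β/π + 3)` (the `Λ′²β` = `βΛ_n²` of the `16^{−n}` value law)

Cell `gate-hubbard-kl`, lane hubbard-kl-c4a-1 (g4); located risk #12 «(C)-VALUE-K0» (memo HOME/hubbard-kl-c4a-1/C4A-PLAN.md §20.4 (iii)).  Per frequency the first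
radial/frequency moment of the slice profile is `≤ 4|c|Λ′` and vanishes for `|ω_{p₀}| > Λ′` (`…C4aSliceMoment`); the number of Matsubara indices with `|ω| ≤ Λ′` is
`≤ Λ′β/π + 3` (`Literature.….card_filter_matsubaraFreq_le`).  Hence the frequency sum of the moments is `≤ 4|c|Λ′(Λ′β/π + 3)`; with LAYER 1's `c = βL²` and its
prefactor `(βL²)⁻²·4!(βL²)³ = 24βL²`, and the `1/β` of the Matsubara sum, this is the `Λ_n²` (plus the thermal `Λ_n/β ≤ (4/π)Λ_n²`) of the `k = 0` slot.

* `setIntegral_sliceMoment_le_indicator` — per frequency: `≤ 4|c|Λ′` if `|ω| ≤ Λ′`, `= 0`-bounded otherwise (indicator form);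
* **`sum_setIntegral_sliceMoment_le`** — the frequency sum `≤ 4|c|·Λ′·(Λ′β/π + 3)`.

Pure bookkeeping; nothing is asserted about the Hubbard model.  References: Salmhofer 1999 §4.2.5 [cite: Salmhofer1999]; BGM 2006 §2.3 [cite: BenfattoGiulianiMastropietro2006].
-/

noncomputable section

namespace Summit.HubbardSuperconductivity.HubbardSuperconductivity.Theorems.C4a

set_option linter.dupNamespace false -- summit = problem name (single-conjunct summit), D-0017

open Real Set MeasureTheory
open Literature.MathematicalPhysics.QuantumLattice

section Sum

variable {Λ Λ' : ℝ} (hΛ : 0 < Λ) (hΛΛ' : Λ ≤ Λ') (c r : ℝ) {β : ℝ} (hβ : 0 < β) (M : ℕ)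
include hΛ hΛΛ'

/-- Per frequency, indicator form: the slice moment is `≤ 4|c|Λ′·𝟙[|ω| ≤ Λ′]`. -/
theorem setIntegral_sliceMoment_le_indicator (w : ℝ) :
    ∫ ξ in Ioo (-r) r, ‖sliceSymbolFnXi c 0 Λ Λ' w ξ‖ * (|ξ| + |w|) ≤ if |w| ≤ Λ' then 4 * |c| * Λ' else 0 := by
  split_ifs with hw
  · exact setIntegral_norm_sliceSymbolFnXi_mul_abs_add_le hΛ hΛΛ' c w r
  · exact le_of_eq (setIntegral_norm_sliceSymbolFnXi_mul_abs_eq_zero_of_lt_abs_freq hΛ hΛΛ' c w r (not_le.1 hw))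

include hβ in
/-- **The slice moment summed over the Matsubara frequencies**: `Σ_{p₀} ∫_{(−r,r)} ‖ŝ(ω_{p₀},ξ)‖·(|ξ| + |ω_{p₀}|) dξ ≤ 4|c|·Λ′·(Λ′β/π + 3)`. -/
theorem sum_setIntegral_sliceMoment_le :
    ∑ p₀ : MatsubaraIdx M, ∫ ξ in Ioo (-r) r, ‖sliceSymbolFnXi c 0 Λ Λ' (matsubaraFreq β M p₀) ξ‖ * (|ξ| + |matsubaraFreq β M p₀|) ≤
      4 * |c| * Λ' * (Λ' * β / π + 3) := by
  classical
  have hΛ' : 0 < Λ' := hΛ.trans_le hΛΛ'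
  calc ∑ p₀ : MatsubaraIdx M, ∫ ξ in Ioo (-r) r, ‖sliceSymbolFnXi c 0 Λ Λ' (matsubaraFreq β M p₀) ξ‖ * (|ξ| + |matsubaraFreq β M p₀|)
      ≤ ∑ p₀ : MatsubaraIdx M, (if |matsubaraFreq β M p₀| ≤ Λ' then 4 * |c| * Λ' else 0) :=
        Finset.sum_le_sum fun p₀ _ => setIntegral_sliceMoment_le_indicator hΛ hΛΛ' c r (matsubaraFreq β M p₀)
    _ = 4 * |c| * Λ' * ((Finset.univ.filter fun p₀ : MatsubaraIdx M => |matsubaraFreq β M p₀| ≤ Λ').card : ℝ) := by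
        rw [Finset.sum_ite, Finset.sum_const_zero, add_zero, Finset.sum_const, nsmul_eq_mul, mul_comm]
    _ ≤ 4 * |c| * Λ' * (Λ' * β / π + 3) := by
        refine mul_le_mul_of_nonneg_left ?_ (by positivity)
        exact card_filter_matsubaraFreq_le hβ hΛ'.le _ fun i hi => (Finset.mem_filter.1 hi).2

end Sum

end Summit.HubbardSuperconductivity.HubbardSuperconductivity.Theorems.C4a

end
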